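import Summits.CriticalPhenomena.PercolationContinuityZ3.Theorems.PercNearOneGluingNoHeavyLowerTailSahiCombMixFiveMoments
import Summits.CriticalPhenomena.PercolationContinuityZ3.Theorems.PercNearOneGluingNoHeavyLowerTailSahiCombMixAtomsFive

/-!
# The comb hierarchy for Sahi's `E_k`, LXXVII: CYLINDER moments of five events ignoring `e` are comb-positive off `e`
# (building blocks for lifting the `q = 1` certificates of the `|G| = 4` cells of comb H-MIX(5))

Support file of the one-cut programme (crux `NoHeavyLowerTail`, stmt-CriticalPhenomena-4575; cell `prim-masterthm`, seat P3, gen 12;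
`run/shared/lean/prim/prim-masterthm/prim-masterthm-p3/HIERARCHY.md` §20).  Extends `…SahiCombMixFiveMoments` (member moments `μ_p(W_S)` and `W_0`-defects): the
CYLINDER `μ_p(W_J ∖ (W_{k_1} ∪ ⋯ ∪ W_{k_r}))` ("in every `W_j`, `j ∈ J`, in no `W_{k_t}`") is the expectation of the nonnegative function
`1_{W_J}·Π_t(1 − 1_{W_{k_t}})`, hence comb-positive at multidegree `1` off `e`; written by inclusion–exclusion as `Σ_{L⊆K}(−1)^{|L|} μ_p(W_{J∪L})` it is a polynomial in the member
moments — the multiplier vocabulary of this seat's LP certificates (kit j132476/j132636/j132637).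
* `combPos_cyl5_one/two/three/four` — `|K| = 1, 2, 3, 4` (the `|K| = 0` case is `combPos_mom5_off`, atoms `|J ∪ K| = 5` are also `combPos_atom5_off`);
* `fam5` — a five-slot family of members as a vector.
HONEST FRAMING: bookkeeping; nothing here asserts (M⁺-k) or `C_k` for `k ≥ 3`. [this work]
-/

noncomputable section

open scoped Classical

namespace Summit.CriticalPhenomena.PercolationContinuityZ3.Theorems

open Finset Function
open Literature.Combinatorics.Sahi2008
open Literature.Probability.Percolation.BHK2006 (ind_le_one ind_inter)
open Literature.Probability.Percolation.DecisionTree (ind ind_of_mem ind_of_not_mem ind_nonneg)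
open SahiComb

namespace SahiMixture

/-- A five-slot family of members as a vector. [folklore] -/
theorem fam5 {α : Type*} {n : ℕ} (A : Fin n → Set α) (R S T U V : Finset (Fin n)) :
    (fun j => ind (⋂ i ∈ (![R, S, T, U, V] : Fin 5 → Finset (Fin n)) j, A i)) =
      ![ind (⋂ i ∈ R, A i), ind (⋂ i ∈ S, A i), ind (⋂ i ∈ T, A i), ind (⋂ i ∈ U, A i), ind (⋂ i ∈ V, A i)] := by
  funext j; fin_cases j <;> rfl

end SahiMixture

variable {ι : Type} [Fintype ι]

namespace SahiCombMix

section Cyl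

variable (W : Fin 5 → Set (Set ι)) (e : ι) (hWe : ∀ (j : Fin 5) (b : Bool), secAt e b (W j) = W j)
include hWe

/-- **Cylinders with one excluded member**: `μ_p(W_J) − μ_p(W_{J∪k}) = μ_p(W_J ∖ W_k)` is comb-positive at multidegree `1` off `e`. [this work] -/
theorem combPos_cyl5_one (J : Finset (Fin 5)) (k : Fin 5) :
    CombPos (update (fun _ : ι => 1) e 0)
      (fun p => ex (bernoulliWeight p) (ind (⋂ i ∈ J, W i)) - ex (bernoulliWeight p) (ind (⋂ i ∈ insert k J, W i))) := by
  have hpt : ∀ ω, ind (⋂ i ∈ J, W i) ω * (1 - ind (W k) ω)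
      = ind (⋂ i ∈ J, W i) ω - ind (⋂ i ∈ insert k J, W i) ω := fun ω => by
    rw [Finset.set_biInter_insert, ind_inter]; ring
  have h0 := (combPos_ex (ι := ι) (h := fun ω => ind (⋂ i ∈ J, W i) ω * (1 - ind (W k) ω)) fun ω =>
      mul_nonneg (ind_nonneg _ ω) (sub_nonneg.2 (ind_le_one _ ω))).of_ignores e
    fun p s => SahiCombDisjunct.ex_update_of_ignores' e (fun ω => by
      show ind (⋂ i ∈ J, W i) (insert e ω) * (1 - ind (W k) (insert e ω)) = ind (⋂ i ∈ J, W i) ω * (1 - ind (W k) ω)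
      rw [ind_biInter5_insert W e hWe, ind_U5_insert W e hWe]) p s
  refine h0.congr fun p => ?_
  have ee := SahiMixture.ex_eq_lin (bernoulliWeight p) (fun ω => ind (⋂ i ∈ J, W i) ω * (1 - ind (W k) ω)) ![1, -1]
    ![ind (⋂ i ∈ J, W i), ind (⋂ i ∈ insert k J, W i)] (fun ω => by
      rw [hpt ω]
      simp only [Fin.sum_univ_succ, Fin.sum_univ_zero, Matrix.cons_val_zero, Matrix.cons_val_succ]
      ring)
  simp only [Fin.sum_univ_succ, Fin.sum_univ_zero, Matrix.cons_val_zero, Matrix.cons_val_succ] at ee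
  rw [ee]; ring

/-- **Cylinders with two excluded members**: `μ_p(W_J ∖ (W_k ∪ W_l))` by inclusion–exclusion, comb-positive at multidegree `1` off `e`. [this work] -/
theorem combPos_cyl5_two (J : Finset (Fin 5)) (k l : Fin 5) :
    CombPos (update (fun _ : ι => 1) e 0)
      (fun p => ex (bernoulliWeight p) (ind (⋂ i ∈ J, W i)) - ex (bernoulliWeight p) (ind (⋂ i ∈ insert k J, W i))
        - ex (bernoulliWeight p) (ind (⋂ i ∈ insert l J, W i)) + ex (bernoulliWeight p) (ind (⋂ i ∈ insert k (insert l J), W i))) := by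
  have hpt : ∀ ω, ind (⋂ i ∈ J, W i) ω * (1 - ind (W k) ω) * (1 - ind (W l) ω)
      = ind (⋂ i ∈ J, W i) ω - ind (⋂ i ∈ insert k J, W i) ω - ind (⋂ i ∈ insert l J, W i) ω
        + ind (⋂ i ∈ insert k (insert l J), W i) ω := fun ω => by
    simp only [Finset.set_biInter_insert, ind_inter]; ring
  have h0 := (combPos_ex (ι := ι) (h := fun ω => ind (⋂ i ∈ J, W i) ω * (1 - ind (W k) ω) * (1 - ind (W l) ω)) fun ω =>
      mul_nonneg (mul_nonneg (ind_nonneg _ ω) (sub_nonneg.2 (ind_le_one _ ω))) (sub_nonneg.2 (ind_le_one _ ω))).of_ignores e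
    fun p s => SahiCombDisjunct.ex_update_of_ignores' e (fun ω => by
      show ind (⋂ i ∈ J, W i) (insert e ω) * (1 - ind (W k) (insert e ω)) * (1 - ind (W l) (insert e ω))
          = ind (⋂ i ∈ J, W i) ω * (1 - ind (W k) ω) * (1 - ind (W l) ω)
      rw [ind_biInter5_insert W e hWe, ind_U5_insert W e hWe, ind_U5_insert W e hWe]) p s
  refine h0.congr fun p => ?_
  have ee := SahiMixture.ex_eq_lin (bernoulliWeight p) (fun ω => ind (⋂ i ∈ J, W i) ω * (1 - ind (W k) ω) * (1 - ind (W l) ω)) ![1, -1, -1, 1]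
    ![ind (⋂ i ∈ J, W i), ind (⋂ i ∈ insert k J, W i), ind (⋂ i ∈ insert l J, W i), ind (⋂ i ∈ insert k (insert l J), W i)] (fun ω => by
      rw [hpt ω]
      simp only [Fin.sum_univ_succ, Fin.sum_univ_zero, Matrix.cons_val_zero, Matrix.cons_val_succ]
      ring)
  simp only [Fin.sum_univ_succ, Fin.sum_univ_zero, Matrix.cons_val_zero, Matrix.cons_val_succ] at ee
  rw [ee]; ring

/-- **Cylinders with three excluded members** (inclusion–exclusion, eight member moments), comb-positive at multidegree `1` off `e`. [this work] -/
theorem combPos_cyl5_three (J : Finset (Fin 5)) (k l m : Fin 5) :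
    CombPos (update (fun _ : ι => 1) e 0)
      (fun p => ex (bernoulliWeight p) (ind (⋂ i ∈ J, W i))
        - ex (bernoulliWeight p) (ind (⋂ i ∈ insert k J, W i)) - ex (bernoulliWeight p) (ind (⋂ i ∈ insert l J, W i))
        - ex (bernoulliWeight p) (ind (⋂ i ∈ insert m J, W i))
        + ex (bernoulliWeight p) (ind (⋂ i ∈ insert k (insert l J), W i)) + ex (bernoulliWeight p) (ind (⋂ i ∈ insert k (insert m J), W i))
        + ex (bernoulliWeight p) (ind (⋂ i ∈ insert l (insert m J), W i))
        - ex (bernoulliWeight p) (ind (⋂ i ∈ insert k (insert l (insert m J)), W i))) := by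
  have hpt : ∀ ω, ind (⋂ i ∈ J, W i) ω * (1 - ind (W k) ω) * (1 - ind (W l) ω) * (1 - ind (W m) ω)
      = ind (⋂ i ∈ J, W i) ω
        - ind (⋂ i ∈ insert k J, W i) ω - ind (⋂ i ∈ insert l J, W i) ω - ind (⋂ i ∈ insert m J, W i) ω
        + ind (⋂ i ∈ insert k (insert l J), W i) ω + ind (⋂ i ∈ insert k (insert m J), W i) ω
        + ind (⋂ i ∈ insert l (insert m J), W i) ω
        - ind (⋂ i ∈ insert k (insert l (insert m J)), W i) ω := fun ω => by
    simp only [Finset.set_biInter_insert, ind_inter]; ring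
  have h0 := (combPos_ex (ι := ι) (h := fun ω => ind (⋂ i ∈ J, W i) ω * (1 - ind (W k) ω) * (1 - ind (W l) ω) * (1 - ind (W m) ω))
      fun ω => mul_nonneg (mul_nonneg (mul_nonneg (ind_nonneg _ ω) (sub_nonneg.2 (ind_le_one _ ω))) (sub_nonneg.2 (ind_le_one _ ω)))
        (sub_nonneg.2 (ind_le_one _ ω))).of_ignores e
    fun p s => SahiCombDisjunct.ex_update_of_ignores' e (fun ω => by
      show ind (⋂ i ∈ J, W i) (insert e ω) * (1 - ind (W k) (insert e ω)) * (1 - ind (W l) (insert e ω)) * (1 - ind (W m) (insert e ω))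
          = ind (⋂ i ∈ J, W i) ω * (1 - ind (W k) ω) * (1 - ind (W l) ω) * (1 - ind (W m) ω)
      rw [ind_biInter5_insert W e hWe, ind_U5_insert W e hWe, ind_U5_insert W e hWe, ind_U5_insert W e hWe]) p s
  refine h0.congr fun p => ?_
  have ee := SahiMixture.ex_eq_lin (bernoulliWeight p)
    (fun ω => ind (⋂ i ∈ J, W i) ω * (1 - ind (W k) ω) * (1 - ind (W l) ω) * (1 - ind (W m) ω)) ![1, -1, -1, -1, 1, 1, 1, -1]
    ![ind (⋂ i ∈ J, W i), ind (⋂ i ∈ insert k J, W i), ind (⋂ i ∈ insert l J, W i), ind (⋂ i ∈ insert m J, W i),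
      ind (⋂ i ∈ insert k (insert l J), W i), ind (⋂ i ∈ insert k (insert m J), W i), ind (⋂ i ∈ insert l (insert m J), W i),
      ind (⋂ i ∈ insert k (insert l (insert m J)), W i)] (fun ω => by
      rw [hpt ω]
      simp only [Fin.sum_univ_succ, Fin.sum_univ_zero, Matrix.cons_val_zero, Matrix.cons_val_succ]
      ring)
  simp only [Fin.sum_univ_succ, Fin.sum_univ_zero, Matrix.cons_val_zero, Matrix.cons_val_succ] at ee
  rw [ee]; ring

/-- **Cylinders with four excluded members** (sixteen member moments), comb-positive at multidegree `1` off `e`. [this work] -/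
theorem combPos_cyl5_four (J : Finset (Fin 5)) (k l m n : Fin 5) :
    CombPos (update (fun _ : ι => 1) e 0)
      (fun p => ex (bernoulliWeight p) (ind (⋂ i ∈ J, W i))
        - ex (bernoulliWeight p) (ind (⋂ i ∈ insert k J, W i)) - ex (bernoulliWeight p) (ind (⋂ i ∈ insert l J, W i))
        - ex (bernoulliWeight p) (ind (⋂ i ∈ insert m J, W i)) - ex (bernoulliWeight p) (ind (⋂ i ∈ insert n J, W i))
        + ex (bernoulliWeight p) (ind (⋂ i ∈ insert k (insert l J), W i)) + ex (bernoulliWeight p) (ind (⋂ i ∈ insert k (insert m J), W i))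
        + ex (bernoulliWeight p) (ind (⋂ i ∈ insert k (insert n J), W i)) + ex (bernoulliWeight p) (ind (⋂ i ∈ insert l (insert m J), W i))
        + ex (bernoulliWeight p) (ind (⋂ i ∈ insert l (insert n J), W i)) + ex (bernoulliWeight p) (ind (⋂ i ∈ insert m (insert n J), W i))
        - ex (bernoulliWeight p) (ind (⋂ i ∈ insert k (insert l (insert m J)), W i))
        - ex (bernoulliWeight p) (ind (⋂ i ∈ insert k (insert l (insert n J)), W i))
        - ex (bernoulliWeight p) (ind (⋂ i ∈ insert k (insert m (insert n J)), W i))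
        - ex (bernoulliWeight p) (ind (⋂ i ∈ insert l (insert m (insert n J)), W i))
        + ex (bernoulliWeight p) (ind (⋂ i ∈ insert k (insert l (insert m (insert n J))), W i))) := by
  have hpt : ∀ ω, ind (⋂ i ∈ J, W i) ω * (1 - ind (W k) ω) * (1 - ind (W l) ω) * (1 - ind (W m) ω) * (1 - ind (W n) ω)
      = ind (⋂ i ∈ J, W i) ω
        - ind (⋂ i ∈ insert k J, W i) ω - ind (⋂ i ∈ insert l J, W i) ω - ind (⋂ i ∈ insert m J, W i) ω - ind (⋂ i ∈ insert n J, W i) ω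
        + ind (⋂ i ∈ insert k (insert l J), W i) ω + ind (⋂ i ∈ insert k (insert m J), W i) ω + ind (⋂ i ∈ insert k (insert n J), W i) ω
        + ind (⋂ i ∈ insert l (insert m J), W i) ω + ind (⋂ i ∈ insert l (insert n J), W i) ω + ind (⋂ i ∈ insert m (insert n J), W i) ω
        - ind (⋂ i ∈ insert k (insert l (insert m J)), W i) ω - ind (⋂ i ∈ insert k (insert l (insert n J)), W i) ω
        - ind (⋂ i ∈ insert k (insert m (insert n J)), W i) ω - ind (⋂ i ∈ insert l (insert m (insert n J)), W i) ω
        + ind (⋂ i ∈ insert k (insert l (insert m (insert n J))), W i) ω := fun ω => by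
    simp only [Finset.set_biInter_insert, ind_inter]; ring
  have h0 := (combPos_ex (ι := ι)
      (h := fun ω => ind (⋂ i ∈ J, W i) ω * (1 - ind (W k) ω) * (1 - ind (W l) ω) * (1 - ind (W m) ω) * (1 - ind (W n) ω))
      fun ω => mul_nonneg (mul_nonneg (mul_nonneg (mul_nonneg (ind_nonneg _ ω) (sub_nonneg.2 (ind_le_one _ ω))) (sub_nonneg.2 (ind_le_one _ ω)))
        (sub_nonneg.2 (ind_le_one _ ω))) (sub_nonneg.2 (ind_le_one _ ω))).of_ignores e
    fun p s => SahiCombDisjunct.ex_update_of_ignores' e (fun ω => by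
      show ind (⋂ i ∈ J, W i) (insert e ω) * (1 - ind (W k) (insert e ω)) * (1 - ind (W l) (insert e ω)) * (1 - ind (W m) (insert e ω))
            * (1 - ind (W n) (insert e ω))
          = ind (⋂ i ∈ J, W i) ω * (1 - ind (W k) ω) * (1 - ind (W l) ω) * (1 - ind (W m) ω) * (1 - ind (W n) ω)
      rw [ind_biInter5_insert W e hWe, ind_U5_insert W e hWe, ind_U5_insert W e hWe, ind_U5_insert W e hWe, ind_U5_insert W e hWe]) p s
  refine h0.congr fun p => ?_
  have ee := SahiMixture.ex_eq_lin (bernoulliWeight p)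
    (fun ω => ind (⋂ i ∈ J, W i) ω * (1 - ind (W k) ω) * (1 - ind (W l) ω) * (1 - ind (W m) ω) * (1 - ind (W n) ω))
    ![1, -1, -1, -1, -1, 1, 1, 1, 1, 1, 1, -1, -1, -1, -1, 1]
    ![ind (⋂ i ∈ J, W i), ind (⋂ i ∈ insert k J, W i), ind (⋂ i ∈ insert l J, W i), ind (⋂ i ∈ insert m J, W i), ind (⋂ i ∈ insert n J, W i),
      ind (⋂ i ∈ insert k (insert l J), W i), ind (⋂ i ∈ insert k (insert m J), W i), ind (⋂ i ∈ insert k (insert n J), W i),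
      ind (⋂ i ∈ insert l (insert m J), W i), ind (⋂ i ∈ insert l (insert n J), W i), ind (⋂ i ∈ insert m (insert n J), W i),
      ind (⋂ i ∈ insert k (insert l (insert m J)), W i), ind (⋂ i ∈ insert k (insert l (insert n J)), W i),
      ind (⋂ i ∈ insert k (insert m (insert n J)), W i), ind (⋂ i ∈ insert l (insert m (insert n J)), W i),
      ind (⋂ i ∈ insert k (insert l (insert m (insert n J))), W i)] (fun ω => by
      rw [hpt ω]
      simp only [Fin.sum_univ_succ, Fin.sum_univ_zero, Matrix.cons_val_zero, Matrix.cons_val_succ]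
      ring)
  simp only [Fin.sum_univ_succ, Fin.sum_univ_zero, Matrix.cons_val_zero, Matrix.cons_val_succ] at ee
  rw [ee]; ring

end Cyl

end SahiCombMix

end Summit.CriticalPhenomena.PercolationContinuityZ3.Theorems

end
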